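import Mathlib
import HarnessLib
import Literature.Analysis.SpecialFunctions.BesselKLaplaceMeasure
import Literature.Analysis.Complex.GeneralDirichletSeriesFibres
import Literature.Analysis.Complex.LaplaceDecaySupportSignedPair

/-!
# Route `HolmgrenBoyleLind`: Lennard-Jones force fields of separated sources, part 12 —
one Fourier shell of a layer sum as a Laplace transform in the depth

Support file for the crux item stmt-AtomisticToContinuum-6075 (`HalfSpaceUniqueContinuation`, line
`registered`, layered core; infrastructure written by a stub-worker of lead c3). ABSTRACT SETTING
(no geometry): a countable family of sources `q` with phases `θ q ∈ ℂ`, `‖θ q‖ ≤ 1`, and heights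
`y q ≥ 0` obeying a uniform window count (at most `N` heights in any `[j, j+1]`), a shell
parameter `c > 0` (`= 2π‖w‖`), an order `ν` and a power `p > 0`, and a shift `t₀ > 0`. The depth
profile of the shell generated by the source `q` observed at depth `X` is
`(X + y q)^{-p} J(X + y q)`, `J(t) = ∫ e^{νu − c t cosh u} du`
(`Literature.Analysis.SpecialFunctions.laplace_besselLaplaceMeasure`:
`t^{-p} J(t) = ∫ e^{-l(t - t₀)} d(besselLaplaceMeasure ν p c t₀)`). We prove:

* `hbl_shellSeries_summable`, `hbl_shell_heights_finite`, `hbl_continuousOn_shellSeries`,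
  `hbl_continuous_shellSeries_max` — the STRUCTURE-FACTOR DIRICHLET SERIES
  `σ(l) = ∑_q θ q · e^{-l · y q}` converges absolutely for `l > 0` with
  `∑_q ‖θ q‖ e^{-l y_q} ≤ N e^{l}/(1 - e^{-l})`, the heights are locally finite, `σ` is continuous
  on `(0, ∞)`, and the regularised series `l ↦ σ(max l c)` is continuous and bounded on `ℝ`;
* **`hbl_hasSum_shell_eq_laplace`** — for `X > t₀`:
  `∑_q θ q (X + y q)^{-p} J(X + y q) = ∫ e^{-l (X - t₀)} σ(max l c) d(besselLaplaceMeasure ν p c t₀)(l)`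
  (the measure is carried by `[c, ∞)`, so `σ(max l c) = σ(l)` a.e.; `tsum`/integral exchanged by
  absolute convergence, `hasSum_integral_of_summable_integral_norm`; the abstract exchange is
  `hbl_hasSum_integral_shellSeries`);
* `hbl_shell_fibres_eq_zero_of_eqOn` — if `σ = 0` on an interval `(c, c + ε)` then every height
  fibre `∑_{q : y q = η} θ q` vanishes (`generalDirichlet_hasSum_zero_of_eqOn_Ioo`,
  `fibre_sum_eq_zero_of_generalDirichlet_hasSum_zero`);
* **`hbl_shell_fibres_eq_zero_of_laplace_eq`** — PEELING ONE SHELL: if the signed profile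
  `α L[σ m₁] − β L[σ m₂]` of two Bessel–Laplace kernel measures with endpoint domination vanishes
  at all large depths (`α ≠ 0`), the fibres vanish
  (`Literature.Analysis.Complex.eqOn_zero_of_laplace_exp_decay_signedPair`).
All `[folklore]`; nothing here closes an item.
-/

noncomputable section

namespace Summit.AtomisticToContinuum.Crystallization.Theorems.HolmgrenBoyleLind

open scoped BigOperators Topology
open MeasureTheory Filter Set Literature.Analysis.SpecialFunctions

section Shell

variable {ι : Type*} [Countable ι] {θ : ι → ℂ} {y : ι → ℝ} {N : ℕ}

/-- The modulus of one term of the structure-factor series: `‖a e^{-x l}‖ = ‖a‖ e^{-l x}` for real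
`x, l`. [folklore] -/
theorem hbl_norm_mul_cexp_neg_mul (a : ℂ) (x l : ℝ) :
    ‖a * Complex.exp (-((x : ℂ) * l))‖ = ‖a‖ * Real.exp (-(l * x)) := by
  rw [norm_mul, ← Complex.ofReal_mul, ← Complex.ofReal_neg, Complex.norm_exp_ofReal, mul_comm x l]

omit [Countable ι] in
/-- Window count ⇒ the height sums `∑_q e^{-l y_q}` converge for `l > 0`, with
`∑_q ‖θ q‖ e^{-l y_q} ≤ N e^{l} / (1 - e^{-l})` (group the sources by `⌊y_q⌋`: at most `N` per
window, geometric series). [folklore] -/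
theorem hbl_shellSeries_summable (hθ : ∀ q, ‖θ q‖ ≤ 1) (hy : ∀ q, 0 ≤ y q)
    (hN : ∀ j : ℕ, {q : ι | (j : ℝ) ≤ y q ∧ y q ≤ j + 1}.encard ≤ N) {l : ℝ} (hl : 0 < l) :
    Summable (fun q => ‖θ q‖ * Real.exp (-(l * y q))) ∧
      ∑' q, ‖θ q‖ * Real.exp (-(l * y q)) ≤ N * Real.exp l / (1 - Real.exp (-l)) := by
  set r : ℝ := Real.exp (-l) with hr
  have hr0 : 0 ≤ r := (Real.exp_pos _).le
  have hr1 : r < 1 := Real.exp_lt_one_iff.2 (neg_lt_zero.2 hl)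
  have hgeom : Summable fun j : ℕ => r ^ j := summable_geometric_of_lt_one hr0 hr1
  -- termwise: `‖θ q‖ e^{-l y_q} ≤ r ^ ⌊y_q⌋₊`
  have hterm : ∀ q, ‖θ q‖ * Real.exp (-(l * y q)) ≤ r ^ ⌊y q⌋₊ := fun q => by
    rw [hr, ← Real.exp_nat_mul]
    calc ‖θ q‖ * Real.exp (-(l * y q)) ≤ 1 * Real.exp (-(l * y q)) := by gcongr; exact hθ q
      _ = Real.exp (-(l * y q)) := one_mul _
      _ ≤ Real.exp (⌊y q⌋₊ * -l) :=
          Real.exp_le_exp.2 (by nlinarith [mul_le_mul_of_nonneg_left (Nat.floor_le (hy q)) hl.le])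
  -- the fibres of `q ↦ ⌊y_q⌋₊` in a finite set have at most `N` elements
  have hcard : ∀ (s : Finset ι) (j : ℕ), ((s.filter fun q => ⌊y q⌋₊ = j).card : ℝ) ≤ N := by
    intro s j
    have h1 : ((s.filter fun q => ⌊y q⌋₊ = j : Finset ι) : Set ι).encard ≤ N := by
      refine (Set.encard_le_encard fun q hq => ?_).trans (hN j)
      have hq' : ⌊y q⌋₊ = j := (Finset.mem_filter.1 (Finset.mem_coe.1 hq)).2
      subst hq'
      exact ⟨Nat.floor_le (hy q), (Nat.lt_floor_add_one (y q)).le⟩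
    rw [Set.encard_coe_eq_coe_finsetCard] at h1
    exact_mod_cast h1
  have hbound : ∀ s : Finset ι, ∑ q ∈ s, ‖θ q‖ * Real.exp (-(l * y q)) ≤ N * (1 - r)⁻¹ := by
    intro s
    calc ∑ q ∈ s, ‖θ q‖ * Real.exp (-(l * y q)) ≤ ∑ q ∈ s, r ^ ⌊y q⌋₊ :=
          Finset.sum_le_sum fun q _ => hterm q
      _ = ∑ j ∈ s.image (fun q => ⌊y q⌋₊), ∑ q ∈ s with ⌊y q⌋₊ = j, r ^ j :=
          (Finset.sum_fiberwise_of_maps_to' (fun q hq => Finset.mem_image_of_mem _ hq) _).symm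
      _ = ∑ j ∈ s.image (fun q => ⌊y q⌋₊), ((s.filter fun q => ⌊y q⌋₊ = j).card : ℝ) * r ^ j := by
          simp only [Finset.sum_const, nsmul_eq_mul]
      _ ≤ ∑ j ∈ s.image (fun q => ⌊y q⌋₊), (N : ℝ) * r ^ j :=
          Finset.sum_le_sum fun j _ => mul_le_mul_of_nonneg_right (hcard s j) (pow_nonneg hr0 j)
      _ = N * ∑ j ∈ s.image (fun q => ⌊y q⌋₊), r ^ j := by rw [Finset.mul_sum]
      _ ≤ N * ∑' j, r ^ j :=
          mul_le_mul_of_nonneg_left (hgeom.sum_le_tsum _ fun j _ => pow_nonneg hr0 j)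
            (Nat.cast_nonneg N)
      _ = N * (1 - r)⁻¹ := by rw [tsum_geometric_of_lt_one hr0 hr1]
  have hnn : ∀ q, 0 ≤ ‖θ q‖ * Real.exp (-(l * y q)) := fun q =>
    mul_nonneg (norm_nonneg _) (Real.exp_pos _).le
  have hsum : Summable fun q => ‖θ q‖ * Real.exp (-(l * y q)) := summable_of_sum_le hnn hbound
  refine ⟨hsum, (hsum.tsum_le_of_sum_le hbound).trans ?_⟩
  rw [div_eq_mul_inv]
  exact mul_le_mul_of_nonneg_right (le_mul_of_one_le_right (Nat.cast_nonneg N)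
    (Real.one_le_exp hl.le)) (inv_nonneg.2 (sub_nonneg.2 hr1.le))

omit [Countable ι] in
/-- Finiteness of the height fibres below any bound (window count). [folklore] -/
theorem hbl_shell_heights_finite (hN : ∀ j : ℕ, {q : ι | (j : ℝ) ≤ y q ∧ y q ≤ j + 1}.encard ≤ N)
    (hy : ∀ q, 0 ≤ y q) (Y : ℝ) : {q : ι | y q ≤ Y}.Finite := by
  refine ((Set.finite_Iic ⌊Y⌋₊).biUnion fun j _ => Set.finite_of_encard_le_coe (hN j)).subset
    fun q hq => ?_
  have hq' : y q ≤ Y := hq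
  simp only [Set.mem_iUnion, Set.mem_Iic, Set.mem_setOf_eq, exists_prop]
  exact ⟨⌊y q⌋₊, Nat.floor_le_floor hq', Nat.floor_le (hy q), (Nat.lt_floor_add_one (y q)).le⟩

omit [Countable ι] in
/-- The structure-factor Dirichlet series `l ↦ ∑_q θ q e^{-l y_q}` is continuous on `(0, ∞)`
(locally uniform absolute convergence, `continuousOn_tsum`). [folklore] -/
theorem hbl_continuousOn_shellSeries (hθ : ∀ q, ‖θ q‖ ≤ 1) (hy : ∀ q, 0 ≤ y q)
    (hN : ∀ j : ℕ, {q : ι | (j : ℝ) ≤ y q ∧ y q ≤ j + 1}.encard ≤ N) :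
    ContinuousOn (fun l : ℝ => ∑' q, θ q * Complex.exp (-((y q : ℂ) * l))) (Ioi 0) := by
  refine isOpen_Ioi.continuousOn_iff.2 fun a ha => ?_
  have ha' : 0 < a := ha
  have hcont : ContinuousOn (fun l : ℝ => ∑' q, θ q * Complex.exp (-((y q : ℂ) * l)))
      (Ioi (a / 2)) := by
    refine continuousOn_tsum (fun q => ?_) (hbl_shellSeries_summable hθ hy hN (half_pos ha')).1
      fun q l hl => ?_
    · exact (by fun_prop : Continuous fun l : ℝ => θ q * Complex.exp (-((y q : ℂ) * l))).continuousOn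
    · have hl' : a / 2 < l := hl
      rw [hbl_norm_mul_cexp_neg_mul]
      exact mul_le_mul_of_nonneg_left (Real.exp_le_exp.2
        (neg_le_neg (mul_le_mul_of_nonneg_right hl'.le (hy q)))) (norm_nonneg _)
  exact hcont.continuousAt (Ioi_mem_nhds (by linarith))

omit [Countable ι] in
/-- The regularised series `l ↦ ∑_q θ q e^{-(max l c) y_q}` (`c > 0`) is continuous on `ℝ` and
bounded by `N e^{c} / (1 - e^{-c})` (uniform domination by the series at `l = c`). [folklore] -/
theorem hbl_continuous_shellSeries_max (hθ : ∀ q, ‖θ q‖ ≤ 1) (hy : ∀ q, 0 ≤ y q)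
    (hN : ∀ j : ℕ, {q : ι | (j : ℝ) ≤ y q ∧ y q ≤ j + 1}.encard ≤ N) {c : ℝ} (hc : 0 < c) :
    Continuous (fun l : ℝ => ∑' q, θ q * Complex.exp (-((y q : ℂ) * ((max l c : ℝ) : ℂ)))) ∧
      ∀ l : ℝ, ‖∑' q, θ q * Complex.exp (-((y q : ℂ) * ((max l c : ℝ) : ℂ)))‖ ≤
        N * Real.exp c / (1 - Real.exp (-c)) := by
  obtain ⟨hS, hle⟩ := hbl_shellSeries_summable hθ hy hN hc
  have hb : ∀ (q : ι) (l : ℝ), ‖θ q * Complex.exp (-((y q : ℂ) * ((max l c : ℝ) : ℂ)))‖ ≤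
      ‖θ q‖ * Real.exp (-(c * y q)) := fun q l => by
    rw [hbl_norm_mul_cexp_neg_mul]
    exact mul_le_mul_of_nonneg_left (Real.exp_le_exp.2
      (neg_le_neg (mul_le_mul_of_nonneg_right (le_max_right l c) (hy q)))) (norm_nonneg _)
  refine ⟨continuous_tsum (fun q => ?_) hS hb,
    fun l => (tsum_of_norm_bounded hS.hasSum fun q => hb q l).trans hle⟩
  exact continuous_const.mul (Complex.continuous_exp.comp (continuous_const.mul
    (Complex.continuous_ofReal.comp (continuous_id.max continuous_const))).neg)

/-- **Summing Laplace transforms inside the integral.** For a finite measure `m` carried by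
`[c, ∞)` (`c > 0`) and `X > t₀`:
`∑_q θ q ∫ e^{-l (X + y_q - t₀)} dm = ∫ e^{-l (X - t₀)} σ(max l c) dm(l)`,
`σ(l) = ∑_q θ q e^{-l y_q}`, the left side converging absolutely
(`hasSum_integral_of_summable_integral_norm`; the `q`-th integrand has modulus
`≤ ‖θ q‖ e^{-c y_q}` `m`-a.e., summable by `hbl_shellSeries_summable`). [folklore] -/
theorem hbl_hasSum_integral_shellSeries (hθ : ∀ q, ‖θ q‖ ≤ 1) (hy : ∀ q, 0 ≤ y q)
    (hN : ∀ j : ℕ, {q : ι | (j : ℝ) ≤ y q ∧ y q ≤ j + 1}.encard ≤ N) {c t₀ X : ℝ} (hc : 0 < c)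
    (hX : t₀ < X) (m : Measure ℝ) [IsFiniteMeasure m] (hmc : m (Iio c) = 0) :
    HasSum (fun q => θ q * ((∫ l, Real.exp (-(l * (X + y q - t₀))) ∂m : ℝ) : ℂ))
      (∫ l, Complex.exp (-((l * (X - t₀) : ℝ) : ℂ)) *
          (∑' q, θ q * Complex.exp (-((y q : ℂ) * ((max l c : ℝ) : ℂ)))) ∂m) := by
  have hae : ∀ᵐ l ∂m, c ≤ l := by
    filter_upwards [measure_eq_zero_iff_ae_notMem.1 hmc] with l hl using not_lt.1 hl
  obtain ⟨hS, -⟩ := hbl_shellSeries_summable hθ hy hN hc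
  -- the integrands and their a.e. bound
  have hGm : ∀ q, AEStronglyMeasurable (fun l : ℝ => Complex.exp (-((l * (X - t₀) : ℝ) : ℂ)) *
      (θ q * Complex.exp (-((y q : ℂ) * ((max l c : ℝ) : ℂ))))) m := fun q =>
    (Continuous.mul (Complex.continuous_exp.comp (Complex.continuous_ofReal.comp
      (continuous_id.mul continuous_const)).neg) (continuous_const.mul
      (Complex.continuous_exp.comp (continuous_const.mul (Complex.continuous_ofReal.comp
      (continuous_id.max continuous_const))).neg))).aestronglyMeasurable
  have hGle : ∀ q, ∀ᵐ l ∂m, ‖Complex.exp (-((l * (X - t₀) : ℝ) : ℂ)) *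
      (θ q * Complex.exp (-((y q : ℂ) * ((max l c : ℝ) : ℂ))))‖ ≤ ‖θ q‖ * Real.exp (-(c * y q)) := by
    intro q
    filter_upwards [hae] with l hl
    rw [norm_mul, ← Complex.ofReal_neg, Complex.norm_exp_ofReal, hbl_norm_mul_cexp_neg_mul,
      max_eq_left hl]
    have h1 : Real.exp (-(l * (X - t₀))) ≤ 1 :=
      Real.exp_le_one_iff.2 (neg_nonpos.2 (mul_nonneg (hc.le.trans hl) (sub_nonneg.2 hX.le)))
    have h2 : Real.exp (-(l * y q)) ≤ Real.exp (-(c * y q)) :=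
      Real.exp_le_exp.2 (neg_le_neg (mul_le_mul_of_nonneg_right hl (hy q)))
    calc Real.exp (-(l * (X - t₀))) * (‖θ q‖ * Real.exp (-(l * y q)))
        ≤ 1 * (‖θ q‖ * Real.exp (-(c * y q))) := by gcongr
      _ = ‖θ q‖ * Real.exp (-(c * y q)) := one_mul _
  have hGi : ∀ q, Integrable (fun l : ℝ => Complex.exp (-((l * (X - t₀) : ℝ) : ℂ)) *
      (θ q * Complex.exp (-((y q : ℂ) * ((max l c : ℝ) : ℂ))))) m := fun q =>
    Integrable.of_bound (hGm q) _ (hGle q)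
  have hGn : ∀ q, ∫ l, ‖Complex.exp (-((l * (X - t₀) : ℝ) : ℂ)) *
      (θ q * Complex.exp (-((y q : ℂ) * ((max l c : ℝ) : ℂ))))‖ ∂m ≤
        ‖θ q‖ * Real.exp (-(c * y q)) * m.real univ := fun q => by
    refine (Real.le_norm_self _).trans (norm_integral_le_of_norm_le_const ?_)
    filter_upwards [hGle q] with l hl
    rwa [norm_norm]
  have hGs : Summable fun q => ∫ l, ‖Complex.exp (-((l * (X - t₀) : ℝ) : ℂ)) *
      (θ q * Complex.exp (-((y q : ℂ) * ((max l c : ℝ) : ℂ))))‖ ∂m :=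
    Summable.of_nonneg_of_le (fun q => integral_nonneg fun l => norm_nonneg _) hGn
      (hS.mul_right _)
  have hA : HasSum (fun q => ∫ l, Complex.exp (-((l * (X - t₀) : ℝ) : ℂ)) *
      (θ q * Complex.exp (-((y q : ℂ) * ((max l c : ℝ) : ℂ)))) ∂m)
      (∫ l, ∑' q, Complex.exp (-((l * (X - t₀) : ℝ) : ℂ)) *
        (θ q * Complex.exp (-((y q : ℂ) * ((max l c : ℝ) : ℂ)))) ∂m) :=
    hasSum_integral_of_summable_integral_norm hGi hGs
  -- the `q`-th integral is `θ q ∫ e^{-l (X + y_q - t₀)} dm`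
  have hkey : ∀ q, θ q * ((∫ l, Real.exp (-(l * (X + y q - t₀))) ∂m : ℝ) : ℂ) =
      ∫ l, Complex.exp (-((l * (X - t₀) : ℝ) : ℂ)) *
        (θ q * Complex.exp (-((y q : ℂ) * ((max l c : ℝ) : ℂ)))) ∂m := fun q => by
    rw [← integral_complex_ofReal, ← integral_const_mul]
    refine integral_congr_ae ?_
    filter_upwards [hae] with l hl
    rw [max_eq_left hl, mul_left_comm, ← Complex.exp_add, Complex.ofReal_exp]
    congr 2
    push_cast
    ring
  -- the sum of the integrands
  have hval : (∫ l, ∑' q, Complex.exp (-((l * (X - t₀) : ℝ) : ℂ)) *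
        (θ q * Complex.exp (-((y q : ℂ) * ((max l c : ℝ) : ℂ)))) ∂m) =
      ∫ l, Complex.exp (-((l * (X - t₀) : ℝ) : ℂ)) *
        (∑' q, θ q * Complex.exp (-((y q : ℂ) * ((max l c : ℝ) : ℂ)))) ∂m :=
    integral_congr_ae (ae_of_all _ fun l => tsum_mul_left)
  rw [hval] at hA
  exact hA.congr_fun hkey

end Shell

/-- **One shell as a Laplace transform in the depth** (registered stub of the line, stated verbatim as
registered; `ι : Type`). For `X > t₀ > 0`, `c, p > 0`:
`∑_q θ q (X + y_q)^{-p} J(X + y_q) = ∫ e^{-l(X - t₀)} σ(max l c) d(besselLaplaceMeasure ν p c t₀)`,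
`J(t) = ∫ e^{νu − c t cosh u} du`, `σ(l) = ∑_q θ q e^{-l y_q}`, the left side converging absolutely
(`hbl_hasSum_integral_shellSeries` for the finite measure `besselLaplaceMeasure ν p c t₀`, carried by
`[c, ∞)`, and the Laplace identity `laplace_besselLaplaceMeasure` termwise). [folklore] -/
theorem hbl_hasSum_shell_eq_laplace : ∀ {ι : Type} [Countable ι] {θ : ι → ℂ} {y : ι → ℝ} {N : ℕ}, (∀ q, ‖θ q‖ ≤ 1) → (∀ q, 0 ≤ y q) → (∀ j : ℕ, {q : ι | (j : ℝ) ≤ y q ∧ y q ≤ j + 1}.encard ≤ N) → ∀ (ν : ℝ) {p c t₀ : ℝ}, 0 < p → 0 < c → 0 < t₀ → ∀ {X : ℝ}, t₀ < X → HasSum (fun q => θ q * ((((X + y q) ^ (-p) : ℝ) * ∫ u : ℝ, Real.exp (ν * u - c * (X + y q) * Real.cosh u) : ℝ) : ℂ)) (∫ l, Complex.exp (-((l * (X - t₀) : ℝ) : ℂ)) * (∑' q, θ q * Complex.exp (-((y q : ℂ) * ((max l c : ℝ) : ℂ)))) ∂(Literature.Analysis.SpecialFunctions.besselLaplaceMeasure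 ν p c t₀)) := by
  intro ι _ θ y N hθ hy hN ν p c t₀ hp hc ht₀ X hX
  haveI := isFiniteMeasure_besselLaplaceMeasure ν hp hc ht₀
  refine (hbl_hasSum_integral_shellSeries hθ hy hN hc hX (besselLaplaceMeasure ν p c t₀)
    (besselLaplaceMeasure_Iio ν hp hc ht₀)).congr_fun fun q => ?_
  rw [laplace_besselLaplaceMeasure ν hp hc ht₀ (by linarith [hy q] : t₀ < X + y q)]

section Peel

variable {ι : Type*} [Countable ι] {θ : ι → ℂ} {y : ι → ℝ} {N : ℕ}

/-- **From an interval of vanishing to empty height fibres.** If the structure-factor series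
`σ(l) = ∑_q θ q e^{-l y_q}` vanishes for all `l` in an interval `(c, c + ε)` (`c, ε > 0`), then
`∑_{q : y_q = η} θ q = 0` for every height `η`. [folklore] -/
theorem hbl_shell_fibres_eq_zero_of_eqOn (hθ : ∀ q, ‖θ q‖ ≤ 1) (hy : ∀ q, 0 ≤ y q)
    (hN : ∀ j : ℕ, {q : ι | (j : ℝ) ≤ y q ∧ y q ≤ j + 1}.encard ≤ N) {c ε : ℝ} (hc : 0 < c)
    (hε : 0 < ε)
    (hzero : ∀ l ∈ Ioo c (c + ε), (∑' q, θ q * Complex.exp (-((y q : ℂ) * l))) = 0) (η : ℝ) :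
    ∑ q ∈ (hbl_shell_heights_finite hN hy η).toFinset with y q = η, θ q = 0 := by
  obtain ⟨hS, -⟩ := hbl_shellSeries_summable hθ hy hN (half_pos hc)
  have hI : ∀ s : ℝ, s ∈ Ioo c (c + ε) →
      HasSum (fun q => θ q * Complex.exp (-((y q : ℂ) * s))) 0 := by
    intro s hs
    have hsum : Summable fun q => θ q * Complex.exp (-((y q : ℂ) * s)) := by
      refine Summable.of_norm_bounded hS fun q => ?_
      rw [hbl_norm_mul_cexp_neg_mul]
      exact mul_le_mul_of_nonneg_left (Real.exp_le_exp.2 (neg_le_neg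
        (mul_le_mul_of_nonneg_right (by linarith [hs.1]) (hy q)))) (norm_nonneg _)
    simpa only [hzero s hs] using hsum.hasSum
  exact Literature.Analysis.Complex.fibre_sum_eq_zero_of_generalDirichlet_hasSum_zero
    (hbl_shell_heights_finite hN hy) le_rfl hS
    (Literature.Analysis.Complex.generalDirichlet_hasSum_zero_of_eqOn_Ioo hy hS
      (by linarith) (by linarith) hI) η

/-- **Peeling one shell.** Let `m₁ = besselLaplaceMeasure ν₁ p₁ c t₀`, `m₂ = besselLaplaceMeasure ν₂ p₂ c t₀`
(`pᵢ, c, t₀ > 0`) and suppose `m₂` is negligible against `m₁` at the endpoint (for every `κ > 0` some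
`(c, c + ε)` on which `m₂ A ≤ κ m₁ A`). If the signed shell profile vanishes at all large depths,
`α ∫ e^{-l(X - t₀)} σ(max l c) dm₁ = β ∫ e^{-l(X - t₀)} σ(max l c) dm₂` for all `X ≥ X₁` with `α ≠ 0`,
`σ(l) = ∑_q θ q e^{-l y_q}`, then every height fibre `∑_{q : y_q = η} θ q` vanishes
(`Literature.Analysis.Complex.eqOn_zero_of_laplace_exp_decay_signedPair` on `(c, c + ε)`, `m₁`
charges every interval there, then `hbl_shell_fibres_eq_zero_of_eqOn`). [folklore] -/
theorem hbl_shell_fibres_eq_zero_of_laplace_eq (hθ : ∀ q, ‖θ q‖ ≤ 1) (hy : ∀ q, 0 ≤ y q)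
    (hN : ∀ j : ℕ, {q : ι | (j : ℝ) ≤ y q ∧ y q ≤ j + 1}.encard ≤ N) (ν₁ ν₂ : ℝ) {p₁ p₂ c t₀ : ℝ}
    (hp₁ : 0 < p₁) (hp₂ : 0 < p₂) (hc : 0 < c) (ht₀ : 0 < t₀)
    (hdom : ∀ κ : ℝ, 0 < κ → ∃ ε : ℝ, 0 < ε ∧ ∀ A : Set ℝ, MeasurableSet A → A ⊆ Ioo c (c + ε) →
      besselLaplaceMeasure ν₂ p₂ c t₀ A ≤ ENNReal.ofReal κ * besselLaplaceMeasure ν₁ p₁ c t₀ A)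
    {α β : ℂ} (hα : α ≠ 0) {X₁ : ℝ}
    (hzero : ∀ X : ℝ, X₁ ≤ X →
      α * (∫ l, Complex.exp (-((l * (X - t₀) : ℝ) : ℂ)) *
          (∑' q, θ q * Complex.exp (-((y q : ℂ) * ((max l c : ℝ) : ℂ))))
            ∂(besselLaplaceMeasure ν₁ p₁ c t₀)) =
      β * (∫ l, Complex.exp (-((l * (X - t₀) : ℝ) : ℂ)) *
          (∑' q, θ q * Complex.exp (-((y q : ℂ) * ((max l c : ℝ) : ℂ))))
            ∂(besselLaplaceMeasure ν₂ p₂ c t₀)))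
    (η : ℝ) : ∑ q ∈ (hbl_shell_heights_finite hN hy η).toFinset with y q = η, θ q = 0 := by
  obtain ⟨hσ, hσM⟩ := hbl_continuous_shellSeries_max hθ hy hN hc
  haveI := isFiniteMeasure_besselLaplaceMeasure ν₁ hp₁ hc ht₀
  haveI := isFiniteMeasure_besselLaplaceMeasure ν₂ hp₂ hc ht₀
  have h₁ : besselLaplaceMeasure ν₁ p₁ c t₀ (Iio 0) = 0 :=
    measure_mono_null (Iio_subset_Iio hc.le) (besselLaplaceMeasure_Iio ν₁ hp₁ hc ht₀)
  have h₂ : besselLaplaceMeasure ν₂ p₂ c t₀ (Iio 0) = 0 :=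
    measure_mono_null (Iio_subset_Iio hc.le) (besselLaplaceMeasure_Iio ν₂ hp₂ hc ht₀)
  -- the admissible ratio `q`: `‖β‖ q < ‖α‖`
  have hα' : 0 < ‖α‖ := norm_pos_iff.2 hα
  have hq0 : 0 < ‖α‖ / (2 * (‖β‖ + 1)) := div_pos hα' (by positivity)
  have hαβ : ‖β‖ * (‖α‖ / (2 * (‖β‖ + 1))) < ‖α‖ := by
    rw [mul_div_assoc', div_lt_iff₀ (by positivity)]
    nlinarith [norm_nonneg β]
  obtain ⟨ε, hε, hdomε⟩ := hdom _ hq0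
  -- the signed Laplace transform vanishes identically for `X ≥ X₁ - t₀`
  have hdecay : ∀ X : ℝ, X₁ - t₀ ≤ X →
      ‖α * (∫ l, Complex.exp (-(l : ℂ) * X) *
          (∑' q, θ q * Complex.exp (-((y q : ℂ) * ((max l c : ℝ) : ℂ))))
            ∂(besselLaplaceMeasure ν₁ p₁ c t₀)) -
        β * (∫ l, Complex.exp (-(l : ℂ) * X) *
          (∑' q, θ q * Complex.exp (-((y q : ℂ) * ((max l c : ℝ) : ℂ))))
            ∂(besselLaplaceMeasure ν₂ p₂ c t₀))‖ ≤ 0 * Real.exp (-(c + ε) * X) := by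
    intro X hX
    have h := hzero (X + t₀) (by linarith)
    have hint : ∀ μ : Measure ℝ, (∫ l, Complex.exp (-((l * (X + t₀ - t₀) : ℝ) : ℂ)) *
        (∑' q, θ q * Complex.exp (-((y q : ℂ) * ((max l c : ℝ) : ℂ)))) ∂μ) =
          ∫ l, Complex.exp (-(l : ℂ) * X) *
            (∑' q, θ q * Complex.exp (-((y q : ℂ) * ((max l c : ℝ) : ℂ)))) ∂μ := fun μ => by
      refine integral_congr_ae (ae_of_all _ fun l => ?_)
      dsimp only
      rw [add_sub_cancel_right, Complex.ofReal_mul, neg_mul]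
    rw [hint, hint] at h
    rw [h, sub_self, norm_zero, zero_mul]
  have hvan := Literature.Analysis.Complex.eqOn_zero_of_laplace_exp_decay_signedPair h₁ h₂ hσ hσM
    α β (by linarith : 0 < c + ε) hdecay le_rfl hq0.le hαβ hdomε
    (fun a' b' ha' hb' _ => besselLaplaceMeasure_Ioo_pos ν₁ hp₁ hc ht₀ ha' hb')
  -- on `(c, c + ε)` the regularised series is the series itself
  refine hbl_shell_fibres_eq_zero_of_eqOn hθ hy hN hc hε (fun l hl => ?_) η
  have h := hvan l hl
  rwa [max_eq_left (le_of_lt hl.1)] at h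

end Peel

end Summit.AtomisticToContinuum.Crystallization.Theorems.HolmgrenBoyleLind

end
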